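import Summits.ResolutionOfSingularities.ResolutionOfSingularities.Theorems.FrobeniusLadderFInjectiveMacaulayficationFDTwoStoreyRowOf
import Summits.ResolutionOfSingularities.ResolutionOfSingularities.Theorems.FrobeniusLadderFInjectiveMacaulayficationFHalfRowOfTwoStoreysGerm
import HarnessLib

/-!
# (W-TD/W8) ROW #8, GERM SHAPE, MODULO ITS TWO DATA MODULES: `FInjectivizationGermAt 2 v` for BED D from storey 1 off `P` + a local storey 2 at `P`
# (crux `FInjectiveMacaulayfication` stmt-ResolutionOfSingularities-15315, chain w45a; res-L1-w45a-plan-1 RULING R21.34 (d) «`f4pos_rowD_twoStorey : FInjectivizationGermAt 2 v`-shape row»;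
# seat res-L1-w45a-stub-1 g13; sequel of ✓ p672137/p672393 `…FDTwoStoreyRowOf` and ✓ `…FHalfRowOfTwoStoreysGerm`)

[OURS · L1 W4.5a] Support file (`--supports stmt-ResolutionOfSingularities-15315 --as helper`); def-free; UNCONDITIONAL (data modules enter as explicit hypotheses);
NOT a statement of any manuscript. Nothing of the crux is proved. AI-written (AI review is weaker than expert review).

* ★ `exists_localSecondStorey_fD_of_support` — from the storey-1 hypotheses (`ι`, `hcompat`, `hoff`, letter of `FDStorey1BlowupFull.storey1_fullCl_off_P_mul`) and the storey-2
  hypotheses (`hIsupp`, `hfull`, letter of `FDStorey2L1BlowupFull.support_idealSheaf_mK` / `affineBlowup_mK_fullCl`): the CLOSED point `P = ι(𝔪̄_P)` over `v` with a local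
  second-storey datum `𝔍` (≠ ⊥, supported at the closed point, all blowings up FULL) and storey 1 FULL off `P` — the common input of the per-floor row and of the germ shape.
* ★★★ `fInjectivizationGermAt_fD_of_support` — `GermForm.FInjectivizationGermAt 2 v`: SOME `𝓚 ≠ ⊥` on `Spec 𝒪_{X_D,v}`, supported at the closed point, ALL of whose blowings up
  are FULL at every stalk (✓ `fInjectivizationGermAt_of_localSecondStorey_affine`).
[cite: Temkin2008, Lemma 2.1.1 and Lemma 2.1.4] [cite: StacksProject, Tag 080B] [cite: GortzWedhorn2020, Prop. 13.91]
-/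

-- single-problem summit: the doubled namespace component is forced
set_option linter.dupNamespace false

noncomputable section

open AlgebraicGeometry CategoryTheory Literature.AlgebraicGeometry.Resolution TopologicalSpace IsLocalRing MvPolynomial

namespace Summit.ResolutionOfSingularities.ResolutionOfSingularities.Theorems.FInjectiveMacaulayfication.FDTwoStoreyRow

open Summit.ResolutionOfSingularities.ResolutionOfSingularities.Theorems.FInjectiveMacaulayfication
open SliceableCentre FDStorey1Fan FDStorey1PIdeal FHalfRowOfTwoStoreys GermForm

variable (k : Type) [Field k]

set_option maxHeartbeats 800000 in
-- large statement; several instance constructions on quotient rings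
/-- ★ **The local second-storey data of BED D** (the point `P`, over `v`, closed; `𝔍` at `P`; storey 1 FULL off `P`) from the two data modules as hypotheses. [OURS · assembly] -/
theorem exists_localSecondStorey_fD_of_support [CharP k 2] (f : MvPolynomial (Fin 5) k)
    (𝔪 : Ideal (MvPolynomial (Fin 5) k ⧸ Ideal.span {f})) (h𝔪 : 𝔪 = Ideal.span (Set.range (fun j : Fin 5 => Ideal.Quotient.mk (Ideal.span {f}) (X j))))
    (v : Spec (.of (MvPolynomial (Fin 5) k ⧸ Ideal.span {f}))) (hv : v.asIdeal = 𝔪)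
    (K₁ : Ideal (MvPolynomial (Fin 5) k ⧸ Ideal.span {f}))
    (ι : Spec (.of (MvPolynomial (Fin 5) k ⧸ Ideal.span {KLocCellKit.evalL k (G (277 : Fin 327))})) ⟶ affineBlowup (𝔪 * K₁))
    [IsOpenImmersion ι]
    (hcompat : ∀ q : Spec (.of (MvPolynomial (Fin 5) k ⧸ Ideal.span {KLocCellKit.evalL k (G (277 : Fin 327))})),
      ((affineBlowup.π _).base (ι.base q)).asIdeal.comap (Ideal.Quotient.mk (Ideal.span {f})) =
        q.asIdeal.comap ((Ideal.Quotient.mk (Ideal.span {KLocCellKit.evalL k (G (277 : Fin 327))})).comp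
          (aeval (fun j : Fin 5 => ∏ i : Fin 5, (X i : MvPolynomial (Fin 5) k) ^ Vq (277 : Fin 327) i j)).toRingHom))
    (hoff : ∀ P₀ : Spec (.of (MvPolynomial (Fin 5) k ⧸ Ideal.span {KLocCellKit.evalL k (G (277 : Fin 327))})),
      P₀.asIdeal = (Ideal.span {x | x ∈ HS.map (KLocCellKit.evalL k)}).map (Ideal.Quotient.mk (Ideal.span {KLocCellKit.evalL k (G (277 : Fin 327))})) →
      ∀ y : ↥(affineBlowup (𝔪 * K₁)), y ≠ ι.base P₀ → FullCl 2 ((affineBlowup (𝔪 * K₁)).presheaf.stalk y))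
    (G₃ : MvPolynomial (Fin 5) k) (hG₃ : G₃ = X 2 ^ 2 + X 0 ^ 3 + X 1 ^ 3 + X 3 * X 4 ^ 4 + X 3 ^ 2 * X 4 + X 2 * X 3 * X 4 ^ 4 + X 2 * X 3 ^ 2 * X 4)
    (I : Ideal (MvPolynomial (Fin 5) k ⧸ Ideal.span {G₃}))
    (hIsupp : ∀ w : Spec (.of (MvPolynomial (Fin 5) k ⧸ Ideal.span {G₃})),
      w.asIdeal = Ideal.span (Set.range (fun j : Fin 5 => Ideal.Quotient.mk (Ideal.span {G₃}) (X j))) →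
      ((affineBlowup.idealSheaf I).support : Set (Spec (.of (MvPolynomial (Fin 5) k ⧸ Ideal.span {G₃})))) = {w})
    (hfull : ∀ y : ↥(affineBlowup I), FullCl 2 ((affineBlowup I).presheaf.stalk y)) :
    ∃ P : ↥(affineBlowup (𝔪 * K₁)), (affineBlowup.π (𝔪 * K₁)).base P = v ∧ IsClosed ({P} : Set ↥(affineBlowup (𝔪 * K₁))) ∧
      (∃ 𝔍 : (Spec ((affineBlowup (𝔪 * K₁)).presheaf.stalk P)).IdealSheafData, 𝔍 ≠ ⊥ ∧
        (∀ s ∈ (𝔍.support : Set (Spec ((affineBlowup (𝔪 * K₁)).presheaf.stalk P))), s = closedPoint ((affineBlowup (𝔪 * K₁)).presheaf.stalk P)) ∧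
        ∀ (S'' : Scheme.{0}) (g : S'' ⟶ Spec ((affineBlowup (𝔪 * K₁)).presheaf.stalk P)), IsBlowup g 𝔍 → ∀ s : S'', FullCl 2 (S''.presheaf.stalk s)) ∧
      ∀ x₁ : ↥(affineBlowup (𝔪 * K₁)), x₁ ≠ P → FullCl 2 ((affineBlowup (𝔪 * K₁)).presheaf.stalk x₁) := by
  classical
  -- the point `P₀ = 𝔪̄_P` of the chart
  have hmax : ((Ideal.span {x | x ∈ HS.map (KLocCellKit.evalL k)}).map
      (Ideal.Quotient.mk (Ideal.span {KLocCellKit.evalL k (G (277 : Fin 327))}))).IsMaximal := by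
    haveI := isMaximal_span_HS k
    refine Ideal.IsMaximal.map_of_surjective_of_ker_le Ideal.Quotient.mk_surjective ?_
    rw [Ideal.mk_ker, Ideal.span_le, Set.singleton_subset_iff]
    exact evalL_G_mem_span_HS k 277 (Or.inr rfl)
  let P₀ : Spec (.of (MvPolynomial (Fin 5) k ⧸ Ideal.span {KLocCellKit.evalL k (G (277 : Fin 327))})) :=
    ⟨(Ideal.span {x | x ∈ HS.map (KLocCellKit.evalL k)}).map (Ideal.Quotient.mk (Ideal.span {KLocCellKit.evalL k (G (277 : Fin 327))})), hmax.isPrime⟩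
  have hP₀ : P₀.asIdeal = (Ideal.span {x | x ∈ HS.map (KLocCellKit.evalL k)}).map
      (Ideal.Quotient.mk (Ideal.span {KLocCellKit.evalL k (G (277 : Fin 327))})) := rfl
  -- over `v`
  have hPx : (affineBlowup.π (𝔪 * K₁)).base (ι.base P₀) = v := by
    apply PrimeSpectrum.ext
    apply Ideal.comap_injective_of_surjective (Ideal.Quotient.mk (Ideal.span {f})) Ideal.Quotient.mk_surjective
    rw [hcompat P₀, hP₀, comap_span_HS]
    refine (QuotientOriginMaximal.idealOfVars_isMaximal k (n := 5)).eq_of_le (Ideal.comap_isPrime _ _).ne_top ?_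
    rw [MvPolynomial.idealOfVars, Ideal.span_le]
    rintro _ ⟨j, rfl⟩
    rw [SetLike.mem_coe, Ideal.mem_comap, hv, h𝔪]
    exact Ideal.subset_span ⟨j, rfl⟩
  -- closed
  have hP : IsClosed ({ι.base P₀} : Set ↥(affineBlowup (𝔪 * K₁))) :=
    isClosed_singleton_of_isOpenImmersion (affineBlowup.π (𝔪 * K₁)) ι P₀ ((PrimeSpectrum.isClosed_singleton_iff_isMaximal P₀).mpr hmax)
  -- storey 2 at `P`
  haveI hpG : (Ideal.span {G₃}).IsPrime := FDStorey2Specimen.isPrime_span_f k G₃ hG₃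
  haveI : IsDomain (MvPolynomial (Fin 5) k ⧸ Ideal.span {G₃}) := Ideal.Quotient.isDomain _
  have hQmax : (Ideal.span (Set.range (fun j : Fin 5 => Ideal.Quotient.mk (Ideal.span {G₃}) (X j)))).IsMaximal := by
    have heq : Ideal.span (Set.range (fun j : Fin 5 => Ideal.Quotient.mk (Ideal.span {G₃}) (X j))) =
        (MvPolynomial.idealOfVars (Fin 5) k).map (Ideal.Quotient.mk (Ideal.span {G₃})) := by
      rw [MvPolynomial.idealOfVars, Ideal.map_span, ← Set.range_comp]
      rfl
    rw [heq]
    haveI := QuotientOriginMaximal.idealOfVars_isMaximal k (n := 5)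
    refine Ideal.IsMaximal.map_of_surjective_of_ker_le Ideal.Quotient.mk_surjective ?_
    rw [Ideal.mk_ker, Ideal.span_le, Set.singleton_subset_iff, SetLike.mem_coe, QuotientOriginMaximal.mem_idealOfVars_iff]
    exact FDStorey2Specimen.constantCoeff_f k G₃ hG₃
  let Q : Spec (.of (MvPolynomial (Fin 5) k ⧸ Ideal.span {G₃})) := ⟨_, hQmax.isPrime⟩
  have hQdef : Q.asIdeal = Ideal.span (Set.range (fun j : Fin 5 => Ideal.Quotient.mk (Ideal.span {G₃}) (X j))) := rfl
  have hsupp := hIsupp Q hQdef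
  have hQne : Q.asIdeal ≠ ⊥ := by
    intro h0
    have hmem : Ideal.Quotient.mk (Ideal.span {G₃}) (X 0) ∈ Q.asIdeal := by rw [hQdef]; exact Ideal.subset_span ⟨0, rfl⟩
    rw [h0, Ideal.mem_bot] at hmem
    exact FDStorey2Specimen.mk_X_ne_zero k G₃ hG₃ 0 hmem
  have hI : I ≠ ⊥ := ne_bot_of_support_eq_singleton I Q hsupp hQne
  have hIQ : Q.asIdeal ≤ I.radical := le_radical_of_support_eq_singleton I Q hsupp
  obtain ⟨σ, -, hσP⟩ := FDStorey2ChartIso.exists_chartEquiv k G₃ hG₃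
  have hQσ : Q.asIdeal.comap σ.toRingHom = P₀.asIdeal := FDStorey2ChartIso.comap_chartEquiv_origin k G₃ σ hσP P₀ hP₀ Q hQdef
  obtain ⟨𝔍, h𝔍, h𝔍supp, hfull₂⟩ := localSecondStorey_of_chartModel 2 ι σ P₀ Q hQσ I hI hIQ hfull
  exact ⟨ι.base P₀, hPx, hP, ⟨𝔍, h𝔍, h𝔍supp, hfull₂⟩, fun x₁ hne => hoff P₀ hP₀ x₁ hne⟩

set_option maxHeartbeats 400000 in
-- large statement
/-- ★★★ **BED D, GERM SHAPE (modulo the two data modules): `FInjectivizationGermAt 2 v`.** [OURS · assembly] [cite: Temkin2008, Lemma 2.1.4] [cite: StacksProject, Tag 080B] -/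
theorem fInjectivizationGermAt_fD_of_support [CharP k 2] (f : MvPolynomial (Fin 5) k) (hf : f = X 4 ^ 4 + X 0 ^ 5 * X 4 + X 0 ^ 6 + X 1 ^ 3 + X 2 ^ 3 + X 3 ^ 7)
    (𝔪 : Ideal (MvPolynomial (Fin 5) k ⧸ Ideal.span {f})) (h𝔪 : 𝔪 = Ideal.span (Set.range (fun j : Fin 5 => Ideal.Quotient.mk (Ideal.span {f}) (X j))))
    (v : Spec (.of (MvPolynomial (Fin 5) k ⧸ Ideal.span {f}))) (hv : v.asIdeal = 𝔪)
    (K₁ : Ideal (MvPolynomial (Fin 5) k ⧸ Ideal.span {f})) (hK₁ : K₁ ≠ ⊥) (h𝔪K₁ : 𝔪 ≤ K₁.radical)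
    (ι : Spec (.of (MvPolynomial (Fin 5) k ⧸ Ideal.span {KLocCellKit.evalL k (G (277 : Fin 327))})) ⟶ affineBlowup (𝔪 * K₁))
    [IsOpenImmersion ι]
    (hcompat : ∀ q : Spec (.of (MvPolynomial (Fin 5) k ⧸ Ideal.span {KLocCellKit.evalL k (G (277 : Fin 327))})),
      ((affineBlowup.π _).base (ι.base q)).asIdeal.comap (Ideal.Quotient.mk (Ideal.span {f})) =
        q.asIdeal.comap ((Ideal.Quotient.mk (Ideal.span {KLocCellKit.evalL k (G (277 : Fin 327))})).comp
          (aeval (fun j : Fin 5 => ∏ i : Fin 5, (X i : MvPolynomial (Fin 5) k) ^ Vq (277 : Fin 327) i j)).toRingHom))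
    (hoff : ∀ P₀ : Spec (.of (MvPolynomial (Fin 5) k ⧸ Ideal.span {KLocCellKit.evalL k (G (277 : Fin 327))})),
      P₀.asIdeal = (Ideal.span {x | x ∈ HS.map (KLocCellKit.evalL k)}).map (Ideal.Quotient.mk (Ideal.span {KLocCellKit.evalL k (G (277 : Fin 327))})) →
      ∀ y : ↥(affineBlowup (𝔪 * K₁)), y ≠ ι.base P₀ → FullCl 2 ((affineBlowup (𝔪 * K₁)).presheaf.stalk y))
    (G₃ : MvPolynomial (Fin 5) k) (hG₃ : G₃ = X 2 ^ 2 + X 0 ^ 3 + X 1 ^ 3 + X 3 * X 4 ^ 4 + X 3 ^ 2 * X 4 + X 2 * X 3 * X 4 ^ 4 + X 2 * X 3 ^ 2 * X 4)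
    (I : Ideal (MvPolynomial (Fin 5) k ⧸ Ideal.span {G₃}))
    (hIsupp : ∀ w : Spec (.of (MvPolynomial (Fin 5) k ⧸ Ideal.span {G₃})),
      w.asIdeal = Ideal.span (Set.range (fun j : Fin 5 => Ideal.Quotient.mk (Ideal.span {G₃}) (X j))) →
      ((affineBlowup.idealSheaf I).support : Set (Spec (.of (MvPolynomial (Fin 5) k ⧸ Ideal.span {G₃})))) = {w})
    (hfull : ∀ y : ↥(affineBlowup I), FullCl 2 ((affineBlowup I).presheaf.stalk y)) :
    FInjectivizationGermAt 2 v := by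
  haveI hp : (Ideal.span {f}).IsPrime := FDSpecimen.isPrime_span_f k f hf
  haveI : IsDomain (MvPolynomial (Fin 5) k ⧸ Ideal.span {f}) := Ideal.Quotient.isDomain _
  have h𝔪ne : 𝔪 ≠ ⊥ := by
    intro h0
    have hmem : Ideal.Quotient.mk (Ideal.span {f}) (X 0) ∈ 𝔪 := by rw [h𝔪]; exact Ideal.subset_span ⟨0, rfl⟩
    rw [h0, Ideal.mem_bot] at hmem
    exact FDSpecimen.mk_X_ne_zero k f hf 0 hmem
  obtain ⟨P, hPx, hP, ⟨𝔍, h𝔍, h𝔍supp, hfull₂⟩, hfull₁⟩ :=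
    exists_localSecondStorey_fD_of_support k f 𝔪 h𝔪 v hv K₁ ι hcompat hoff G₃ hG₃ I hIsupp hfull
  exact fInjectivizationGermAt_of_localSecondStorey_affine 2 𝔪 K₁ h𝔪ne hK₁ v (by rw [hv]; exact Ideal.le_radical) (by rw [hv]; exact h𝔪K₁)
    P hPx hP 𝔍 h𝔍 h𝔍supp hfull₂ (fun x₁ hne _ => hfull₁ x₁ hne)

end Summit.ResolutionOfSingularities.ResolutionOfSingularities.Theorems.FInjectiveMacaulayfication.FDTwoStoreyRow

end
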